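import Literature.Probability.Percolation.OneArmAverageDifference
import HarnessLib

/-!
# A weak form of LSW's Lemma 2.3 for random variables: window differences from tail bounds (proofs only)

Topic `Probability/Percolation`; theorems only, a sequel of `OneArmAverageDifference`
(`intervalIntegral_measureReal_sub_le`: `∫_a^{a+1} (u₂ - u₁) ≤ E[min{log X₁ - log X₂, 1}]` for
random variables `0 < X₂ ≤ X₁`, `uᵢ(s) = P[Xᵢ ≤ e^{-s}]`). Lemma 2.3 of Lawler–Schramm–Werner,
*One-arm exponent for critical 2D percolation*, Electron. J. Probab. **7** (2002), paper no. 2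
(pp. 6–7) is the Neumann estimate `h̃(2π, t) - h̃(θ, t) = o(2π - θ)` for the window averages
`h̃(θ, t) = ∫₀¹ h(θ, t + s) ds` of `h(θ, t) = P[𝔯(θ) ≤ e^{-t}]`, obtained from the three-arm
tail (2.14) `P[diam Q' ≥ r] ≤ c (ε/r)^{1+α}` (`ε = 2π - θ`, `Q(2π) = Q(θ) ∪ Q'`) and the
deterministic estimate `min{log 𝔯(θ) - log 𝔯(2π), 1} ≤ C (diam Q')²` ((2.15)–(2.16), harmonic
measure). The identification theorem of the tree
(`lswHit_two_pi_eq_measureReal_of_renewal`, `OneArmTraceIdentification.lean`) needs this only to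
order `o((2π - θ)^{1/3})`, and to that order the harmonic-free deficit bound
`min{log 𝔯(K) - log 𝔯(K ∪ K'), 1} ≤ 2 √(32 r/ρ₀)` (`K' ⊆ B̄(ζ, r)`, `|ζ| ≥ 1`, `𝔯(K) ≥ ρ₀`;
Koebe distortion, `Literature/Analysis/Complex/ConformalRadiusKoebeDeficit.lean`) suffices. This
file is the measure-theoretic half of that route, for random variables `0 < X₂ ≤ X₁` on a
probability space (`X₁ = 𝔯(θ)`, `X₂ = 𝔯(2π)`):

* `intervalIntegral_measureReal_sub_le_indicator` — the Fubini bridge with a window of length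
  `L ≤ 1` and restricted to `{X₁ > e^{-(a+1)}}`:
  `∫_a^{a+L} (u₂ - u₁) ≤ E[min{log X₁ - log X₂, 1}; X₁ > e^{-(a+1)}]` (configurations with
  `X₁ ≤ e^{-(a+1)}` have `uᵢ = 1` on the whole window and do not contribute; this is what makes a
  deficit bound with the factor `𝔯(θ)^{-1/2}` usable);
* `integral_le_add_measureReal_lt` — `E[f] ≤ b + P[f > b]` for `0 ≤ f ≤ 1`, `b ≥ 0`;
* `intervalIntegral_measureReal_sub_le_of_tail` — hence, if for all `r > 0`
  `P[X₁ > ρ₀ ∧ min{log X₁ - log X₂, 1} > 2 √(32 r/ρ₀)] ≤ c (ε/r)^γ` (`ρ₀ = e^{-(a+1)}`; in LSW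
  this event is contained in `{Q' ⊄ B̄(1, r)}`), then
  `∫_a^{a+L} (u₂ - u₁) ≤ (2 √(32/ρ₀) + c) ε^{γ/(1+2γ)}` (take `r = ε^{2γ/(1+2γ)}`);
* `eventually_le_mul_rpow_one_third` — `C (2π - θ)^p ≤ ε' (2π - θ)^{1/3}` eventually as
  `θ ↑ 2π` when `p > 1/3`; `γ/(1 + 2γ) > 1/3` iff `γ > 1`, which is where LSW's three-arm
  exponent `1 + α > 1` of (2.13) enters;
* `eventually_window_sub_ge_of_tail` — **the weak Lemma 2.3 for a family**: for probability
  measures `P_θ` on one measurable space, random variables `0 < X₂ ≤ X₁^θ` with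
  `P_θ[X₂ ≤ e^{-s}] = w(s)` for all `θ`, and tails
  `P_θ[X₁^θ > ρ₀ ∧ min{…, 1} > 2 √(32 r/ρ₀)] ≤ c ((2π - θ)/r)^γ` (`γ > 1`, all `ρ₀, r > 0`,
  `θ` near `2π`), one has for every `L ∈ [0, 1]`, `t`, `ε' > 0`, eventually as `θ ↑ 2π`:
  `∫₀ᴸ P_θ[X₁^θ ≤ e^{-(t+r)}] dr - ∫₀ᴸ w(t + r) dr ≥ -ε' (2π - θ)^{1/3}` — the shape of the
  flatness hypothesis of `lswHit_two_pi_eq_measureReal_of_renewal` once LSW's (2.10) identifies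
  `P_θ[X₁^θ ≤ e^{-·}]` with the renewal extension `renewalST 6 1_{≤0} w θ`.

No new definitions, no named facts.

## References

* G. F. Lawler, O. Schramm, W. Werner, *One-arm exponent for critical 2D percolation*, Electron.
  J. Probab. 7 (2002), no. 2, Lemma 2.3 and its proof, (2.13)–(2.16) (pp. 6–7)
  [LawlerSchrammWernerEJP2002].

## Mathlib / tree

Tree: `intervalIntegral_measureReal_sub_le`, `measureReal_le_exp_neg_mono`
(`OneArmAverageDifference`). Mathlib: `intervalIntegral.integral_add_adjacent_intervals`,
`integral_indicator_one`, `Real.rpow_add`, `Real.rpow_mul`, `Real.sqrt_eq_rpow`,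
`Filter.Tendsto.eventually_lt_const`.
-/

noncomputable section

open MeasureTheory Filter Topology Set
open scoped NNReal

namespace Literature.Probability.Percolation

section Bridge

variable {Ω : Type*} [MeasurableSpace Ω] (P : Measure Ω) [IsProbabilityMeasure P] {X₁ X₂ : Ω → ℝ}

/-- Distribution functions `s ↦ P[X ≤ e^{-s}]` are antitone. [folklore] -/
theorem antitone_measureReal_le_exp_neg (X : Ω → ℝ) :
    Antitone fun s ↦ P.real {ω | X ω ≤ Real.exp (-s)} := fun _ _ hab ↦
  measureReal_mono fun ω (hω : X ω ≤ Real.exp (-_)) ↦ hω.trans (Real.exp_le_exp.2 (by linarith))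

/-- **The Fubini bridge with a short window, restricted to `{X₁ > e^{-(a+1)}}`.** For random
variables `0 < X₂ ≤ X₁`, `uᵢ(s) = P[Xᵢ ≤ e^{-s}]`, `L ≤ 1` and every `a`:
`∫_a^{a+L} (u₂ - u₁) ≤ E[min{log X₁ - log X₂, 1}; X₁ > e^{-(a+1)}]`. Proof: the integrand is
`≥ 0`, so the window may be extended to `[a, a + 1]`; then apply `intervalIntegral_measureReal_sub_le`
to `X₁' = X₁` on `{X₁ > e^{-(a+1)}}`, `X₁' = X₂` elsewhere, whose distribution function agrees
with `u₁` on `s ≤ a + 1`. [cite: LawlerSchrammWernerEJP2002, proof of Lemma 2.3 (p. 7, last display)] -/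
theorem intervalIntegral_measureReal_sub_le_indicator (hX₁ : Measurable X₁) (hX₂ : Measurable X₂)
    (hpos : ∀ ω, 0 < X₂ ω) (hle : ∀ ω, X₂ ω ≤ X₁ ω) (a : ℝ) {L : ℝ} (hL1 : L ≤ 1) :
    ∫ s in a..a + L, (P.real {ω | X₂ ω ≤ Real.exp (-s)} - P.real {ω | X₁ ω ≤ Real.exp (-s)}) ≤
      ∫ ω, {ω | Real.exp (-(a + 1)) < X₁ ω}.indicator
        (fun ω ↦ min (Real.log (X₁ ω) - Real.log (X₂ ω)) 1) ω ∂P := by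
  set g : ℝ → ℝ := fun s ↦ P.real {ω | X₂ ω ≤ Real.exp (-s)} - P.real {ω | X₁ ω ≤ Real.exp (-s)}
    with hgdef
  have hg0 : ∀ s, 0 ≤ g s := fun s ↦ by
    have := measureReal_le_exp_neg_mono P hle s
    simp only [hgdef]
    linarith
  have hgi : ∀ b c : ℝ, IntervalIntegrable g volume b c := fun b c ↦
    ((antitone_measureReal_le_exp_neg P X₂).intervalIntegrable).sub
      ((antitone_measureReal_le_exp_neg P X₁).intervalIntegrable)
  -- Step 1: extend the window to `[a, a + 1]`
  have h1 : ∫ s in a..a + L, g s ≤ ∫ s in a..a + 1, g s := by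
    rw [← intervalIntegral.integral_add_adjacent_intervals (hgi a (a + L)) (hgi (a + L) (a + 1))]
    have : 0 ≤ ∫ s in (a + L)..(a + 1), g s :=
      intervalIntegral.integral_nonneg (by linarith) fun s _ ↦ hg0 s
    linarith
  -- Step 2: the modified variable
  set ρ₀ : ℝ := Real.exp (-(a + 1)) with hρ₀
  set X₁' : Ω → ℝ := fun ω ↦ if ρ₀ < X₁ ω then X₁ ω else X₂ ω with hX₁'def
  have hX₁' : Measurable X₁' := Measurable.ite (measurableSet_lt measurable_const hX₁) hX₁ hX₂
  have hle' : ∀ ω, X₂ ω ≤ X₁' ω := fun ω ↦ by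
    simp only [hX₁'def]
    split_ifs
    · exact hle ω
    · exact le_rfl
  have hbridge := intervalIntegral_measureReal_sub_le P hX₁' hX₂ hpos hle' a
  -- Step 3: the distribution functions of `X₁'` and `X₁` agree for `s ≤ a + 1`
  have hset : ∀ s, s ≤ a + 1 → {ω | X₁' ω ≤ Real.exp (-s)} = {ω | X₁ ω ≤ Real.exp (-s)} := by
    intro s hs
    ext ω
    simp only [mem_setOf_eq, hX₁'def]
    have hρs : ρ₀ ≤ Real.exp (-s) := Real.exp_le_exp.2 (by linarith)
    split_ifs with h
    · exact Iff.rfl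
    · push Not at h
      exact ⟨fun _ ↦ h.trans hρs, fun _ ↦ (hle ω).trans (h.trans hρs)⟩
  have h2 : ∫ s in a..a + 1, g s =
      ∫ s in a..a + 1, (P.real {ω | X₂ ω ≤ Real.exp (-s)} - P.real {ω | X₁' ω ≤ Real.exp (-s)}) := by
    refine intervalIntegral.integral_congr fun s hs ↦ ?_
    rw [uIcc_of_le (by linarith)] at hs
    simp only [hgdef]
    rw [hset s hs.2]
  -- Step 4: the right sides agree
  have h3 : (fun ω ↦ min (Real.log (X₁' ω) - Real.log (X₂ ω)) 1) =
      {ω | ρ₀ < X₁ ω}.indicator (fun ω ↦ min (Real.log (X₁ ω) - Real.log (X₂ ω)) 1) := by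
    funext ω
    simp only [hX₁'def, indicator, mem_setOf_eq]
    split_ifs with h
    · rfl
    · simp
  calc ∫ s in a..a + L, g s ≤ ∫ s in a..a + 1, g s := h1
    _ = ∫ s in a..a + 1, (P.real {ω | X₂ ω ≤ Real.exp (-s)} - P.real {ω | X₁' ω ≤ Real.exp (-s)}) := h2
    _ ≤ ∫ ω, min (Real.log (X₁' ω) - Real.log (X₂ ω)) 1 ∂P := hbridge
    _ = _ := by rw [h3]

/-- **`E[f] ≤ b + P[f > b]`** for a measurable `f` with values in `[0, 1]` and `b ≥ 0`
(`f ≤ b + 𝟙{f > b}`). [folklore] -/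
theorem integral_le_add_measureReal_lt {f : Ω → ℝ} (hfm : Measurable f) (hf0 : ∀ ω, 0 ≤ f ω)
    (hf1 : ∀ ω, f ω ≤ 1) {b : ℝ} (hb : 0 ≤ b) :
    ∫ ω, f ω ∂P ≤ b + P.real {ω | b < f ω} := by
  have hms : MeasurableSet {ω | b < f ω} := measurableSet_lt measurable_const hfm
  have hptw : ∀ ω, f ω ≤ b + ({ω | b < f ω} : Set Ω).indicator (1 : Ω → ℝ) ω := by
    intro ω
    by_cases h : b < f ω
    · rw [indicator_of_mem (show ω ∈ {ω | b < f ω} from h), Pi.one_apply]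
      linarith [hf1 ω]
    · rw [indicator_of_notMem (show ω ∉ {ω | b < f ω} from h)]
      push Not at h
      linarith
  have hint : Integrable f P := Integrable.of_bound hfm.aestronglyMeasurable 1
    (Eventually.of_forall fun ω ↦ by
      rw [Real.norm_eq_abs, abs_of_nonneg (hf0 ω)]; exact hf1 ω)
  have hint2 : Integrable (fun ω ↦ b + ({ω | b < f ω} : Set Ω).indicator (1 : Ω → ℝ) ω) P :=
    (integrable_const b).add ((integrable_const (1 : ℝ)).indicator hms)
  calc ∫ ω, f ω ∂P ≤ ∫ ω, (b + ({ω | b < f ω} : Set Ω).indicator (1 : Ω → ℝ) ω) ∂P :=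
        integral_mono hint hint2 hptw
    _ = b + P.real {ω | b < f ω} := by
        have hind : Integrable (fun ω ↦ ({ω | b < f ω} : Set Ω).indicator (1 : Ω → ℝ) ω) P :=
          (integrable_const (1 : ℝ)).indicator hms
        have hadd := integral_add (integrable_const b) hind
        rw [hadd, integral_const, integral_indicator_one hms]
        simp

/-- **Window differences from a tail bound.** For random variables `0 < X₂ ≤ X₁`,
`uᵢ(s) = P[Xᵢ ≤ e^{-s}]`, `L ≤ 1`, `ρ₀ = e^{-(a+1)}`, and constants `c`, `γ > 0`, `ε > 0`: if for all `r > 0`, `P[X₁ > ρ₀ ∧ min{log X₁ - log X₂, 1} > 2 √(32 r/ρ₀)] ≤ c (ε/r)^γ`,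
then `∫_a^{a+L} (u₂ - u₁) ≤ (2 √(32/ρ₀) + c) ε^{γ/(1 + 2γ)}`. In LSW (`X₁ = 𝔯(θ)`,
`X₂ = 𝔯(2π)`, `ε = 2π - θ`) the event is contained in `{Q' ⊄ B̄(1, r)}` by the deficit bound of
`ConformalRadiusKoebeDeficit`, and its probability is (2.14); the choice `r = ε^{2γ/(1+2γ)}`
balances the two terms. [cite: LawlerSchrammWernerEJP2002, proof of Lemma 2.3, (2.14)–(2.16) (p. 7)] -/
theorem intervalIntegral_measureReal_sub_le_of_tail (hX₁ : Measurable X₁) (hX₂ : Measurable X₂)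
    (hpos : ∀ ω, 0 < X₂ ω) (hle : ∀ ω, X₂ ω ≤ X₁ ω) (a : ℝ) {L : ℝ} (hL1 : L ≤ 1)
    {c γ ε : ℝ} (hγ : 0 < γ) (hε : 0 < ε)
    (htail : ∀ r : ℝ, 0 < r →
      P.real {ω | Real.exp (-(a + 1)) < X₁ ω ∧
        2 * Real.sqrt (32 * r / Real.exp (-(a + 1))) <
          min (Real.log (X₁ ω) - Real.log (X₂ ω)) 1} ≤ c * (ε / r) ^ γ) :
    ∫ s in a..a + L, (P.real {ω | X₂ ω ≤ Real.exp (-s)} - P.real {ω | X₁ ω ≤ Real.exp (-s)}) ≤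
      (2 * Real.sqrt (32 / Real.exp (-(a + 1))) + c) * ε ^ (γ / (1 + 2 * γ)) := by
  set ρ₀ : ℝ := Real.exp (-(a + 1)) with hρ₀
  have hρ₀pos : 0 < ρ₀ := Real.exp_pos _
  set p : ℝ := γ / (1 + 2 * γ) with hp
  have h12 : 0 < 1 + 2 * γ := by linarith
  set r : ℝ := ε ^ (2 * p) with hr
  have hrpos : 0 < r := Real.rpow_pos_of_pos hε _
  -- the two terms at `r = ε^{2p}`
  have hsqrt_r : Real.sqrt r = ε ^ p := by
    rw [hr, Real.sqrt_eq_rpow, ← Real.rpow_mul hε.le]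
    congr 1
    ring
  have hratio : (ε / r) ^ γ = ε ^ p := by
    rw [hr, show ε / ε ^ (2 * p) = ε ^ (1 - 2 * p) by
      rw [Real.rpow_sub hε, Real.rpow_one], ← Real.rpow_mul hε.le]
    congr 1
    rw [hp]
    field_simp
    ring
  -- the restricted defect `f`
  set f : Ω → ℝ := {ω | ρ₀ < X₁ ω}.indicator
    (fun ω ↦ min (Real.log (X₁ ω) - Real.log (X₂ ω)) 1) with hf
  have hmin0 : ∀ ω, 0 ≤ min (Real.log (X₁ ω) - Real.log (X₂ ω)) 1 := fun ω ↦
    le_min (by linarith [Real.log_le_log (hpos ω) (hle ω)]) zero_le_one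
  have hf0 : ∀ ω, 0 ≤ f ω := fun ω ↦ by
    simp only [hf, indicator]
    split_ifs
    · exact hmin0 ω
    · exact le_rfl
  have hf1 : ∀ ω, f ω ≤ 1 := fun ω ↦ by
    simp only [hf, indicator]
    split_ifs
    · exact min_le_right _ _
    · exact zero_le_one
  have hfm : Measurable f :=
    (((Real.measurable_log.comp hX₁).sub (Real.measurable_log.comp hX₂)).min measurable_const).indicator
      (measurableSet_lt measurable_const hX₁)
  set b : ℝ := 2 * Real.sqrt (32 * r / ρ₀) with hb
  have hb0 : 0 ≤ b := by positivity
  have hkey : {ω | b < f ω} = {ω | ρ₀ < X₁ ω ∧ b < min (Real.log (X₁ ω) - Real.log (X₂ ω)) 1} := by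
    ext ω
    simp only [mem_setOf_eq, hf, indicator]
    split_ifs with h
    · exact ⟨fun hlt ↦ ⟨h, hlt⟩, fun hh ↦ hh.2⟩
    · constructor
      · intro hlt; linarith
      · intro hh; exact absurd hh.1 h
  have hE := integral_le_add_measureReal_lt P hfm hf0 hf1 hb0
  rw [hkey] at hE
  have hT := htail r hrpos
  have hbval : b = 2 * Real.sqrt (32 / ρ₀) * ε ^ p := by
    rw [hb, show 32 * r / ρ₀ = 32 / ρ₀ * r by ring, Real.sqrt_mul (by positivity), hsqrt_r]
    ring
  calc ∫ s in a..a + L, (P.real {ω | X₂ ω ≤ Real.exp (-s)} - P.real {ω | X₁ ω ≤ Real.exp (-s)})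
      ≤ ∫ ω, f ω ∂P := intervalIntegral_measureReal_sub_le_indicator P hX₁ hX₂ hpos hle a hL1
    _ ≤ b + P.real {ω | ρ₀ < X₁ ω ∧ b < min (Real.log (X₁ ω) - Real.log (X₂ ω)) 1} := hE
    _ ≤ b + c * (ε / r) ^ γ := by linarith
    _ = (2 * Real.sqrt (32 / ρ₀) + c) * ε ^ p := by rw [hbval, hratio]; ring

end Bridge

/-! ### Eventually-forms as `θ ↑ 2π` -/

/-- `C (2π - θ)^p ≤ ε' (2π - θ)^{1/3}` eventually as `θ ↑ 2π`, for `p > 1/3` and `ε' > 0`;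
hence a bound `F(θ) ≤ C (2π - θ)^p` eventually gives `F(θ) ≤ ε' (2π - θ)^{1/3}` eventually.
[folklore] -/
theorem eventually_le_mul_rpow_one_third {F : ℝ → ℝ} {C p : ℝ} (hp : 1 / 3 < p)
    (hF : ∀ᶠ θ in 𝓝[<] (2 * Real.pi), F θ ≤ C * (2 * Real.pi - θ) ^ p) {ε' : ℝ} (hε' : 0 < ε') :
    ∀ᶠ θ in 𝓝[<] (2 * Real.pi), F θ ≤ ε' * (2 * Real.pi - θ) ^ (1 / 3 : ℝ) := by
  have hq : 0 < p - 1 / 3 := by linarith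
  -- `C (2π - θ)^{p - 1/3} → C · 0 = 0 < ε'`
  have hd : Tendsto (fun θ : ℝ ↦ 2 * Real.pi - θ) (𝓝[<] (2 * Real.pi)) (𝓝 0) := by
    have : Tendsto (fun θ : ℝ ↦ 2 * Real.pi - θ) (𝓝 (2 * Real.pi)) (𝓝 (2 * Real.pi - 2 * Real.pi)) :=
      (continuous_const.sub continuous_id).tendsto _
    rw [sub_self] at this
    exact this.mono_left nhdsWithin_le_nhds
  have hpow : Tendsto (fun θ : ℝ ↦ C * (2 * Real.pi - θ) ^ (p - 1 / 3)) (𝓝[<] (2 * Real.pi))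
      (𝓝 0) := by
    have h0 : Tendsto (fun x : ℝ ↦ x ^ (p - 1 / 3)) (𝓝 0) (𝓝 0) := by
      have := (Real.continuousAt_rpow_const 0 (p - 1 / 3) (Or.inr hq.le)).tendsto
      rwa [Real.zero_rpow hq.ne'] at this
    have := (h0.comp hd).const_mul C
    rwa [mul_zero] at this
  have hsmall : ∀ᶠ θ in 𝓝[<] (2 * Real.pi), C * (2 * Real.pi - θ) ^ (p - 1 / 3) < ε' :=
    hpow.eventually_lt_const hε'
  have hlt : ∀ᶠ θ in 𝓝[<] (2 * Real.pi), θ < 2 * Real.pi := self_mem_nhdsWithin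
  filter_upwards [hF, hsmall, hlt] with θ hθF hθs hθlt
  have hdpos : 0 < 2 * Real.pi - θ := by linarith
  have hsplit : (2 * Real.pi - θ) ^ p = (2 * Real.pi - θ) ^ (p - 1 / 3) * (2 * Real.pi - θ) ^ (1 / 3 : ℝ) := by
    rw [← Real.rpow_add hdpos]
    congr 1
    ring
  calc F θ ≤ C * (2 * Real.pi - θ) ^ p := hθF
    _ = C * (2 * Real.pi - θ) ^ (p - 1 / 3) * (2 * Real.pi - θ) ^ (1 / 3 : ℝ) := by
        rw [hsplit, mul_assoc]
    _ ≤ ε' * (2 * Real.pi - θ) ^ (1 / 3 : ℝ) :=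
        mul_le_mul_of_nonneg_right hθs.le (Real.rpow_nonneg hdpos.le _)

section Family

variable {Ω : Type*} [MeasurableSpace Ω]

/-- **The weak Lemma 2.3 for a family of couplings.** Let `P_θ` (`θ ∈ ℝ`) be probability measures
on one measurable space, `X₁^θ, X₂ : Ω → ℝ` measurable with `0 < X₂ ≤ X₁^θ`, and suppose the
law of `X₂` is the same under every `P_θ`: `P_θ[X₂ ≤ e^{-s}] = w(s)`. If for some `θ₁ < 2π`,
`c` and `γ > 1`, for all `θ ∈ (θ₁, 2π)`, `ρ₀ > 0`, `r > 0`: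
`P_θ[X₁^θ > ρ₀ ∧ min{log X₁^θ - log X₂, 1} > 2 √(32 r/ρ₀)] ≤ c ((2π - θ)/r)^γ`, then for every
`L ≤ 1`, `t ∈ ℝ` and `ε' > 0`, eventually as `θ ↑ 2π`,
`-ε' (2π - θ)^{1/3} ≤ ∫₀ᴸ P_θ[X₁^θ ≤ e^{-(t+r)}] dr - ∫₀ᴸ w(t + r) dr`. In LSW: `X₁^θ = 𝔯(θ)`,
`X₂ = 𝔯(2π)` under a coupling of `Q(θ) ⊆ Q(2π)`, the event lies in `{Q' ⊄ B̄(1, r)}`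
(`ConformalRadiusKoebeDeficit`), whose probability is (2.14) with `γ = 1 + α`; after (2.10) the
left integral is the renewal extension of the window average of `w`, and the conclusion is the
flatness hypothesis of `lswHit_two_pi_eq_measureReal_of_renewal`.
[cite: LawlerSchrammWernerEJP2002, Lemma 2.3 (2.12) and its proof (pp. 6–7)] -/
theorem eventually_window_sub_ge_of_tail (P : ℝ → Measure Ω) [∀ θ, IsProbabilityMeasure (P θ)]
    {X₁ : ℝ → Ω → ℝ} {X₂ : Ω → ℝ} (hX₁ : ∀ θ, Measurable (X₁ θ)) (hX₂ : Measurable X₂)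
    (hpos : ∀ ω, 0 < X₂ ω) (hle : ∀ θ ω, X₂ ω ≤ X₁ θ ω) {w : ℝ → ℝ}
    (hw : ∀ θ s, (P θ).real {ω | X₂ ω ≤ Real.exp (-s)} = w s)
    {θ₁ c γ : ℝ} (hθ₁ : θ₁ < 2 * Real.pi) (hγ : 1 < γ)
    (htail : ∀ θ ∈ Ioo θ₁ (2 * Real.pi), ∀ ρ₀ : ℝ, 0 < ρ₀ → ∀ r : ℝ, 0 < r →
      (P θ).real {ω | ρ₀ < X₁ θ ω ∧
        2 * Real.sqrt (32 * r / ρ₀) < min (Real.log (X₁ θ ω) - Real.log (X₂ ω)) 1} ≤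
        c * ((2 * Real.pi - θ) / r) ^ γ)
    {L : ℝ} (hL1 : L ≤ 1) (t : ℝ) {ε' : ℝ} (hε' : 0 < ε') :
    ∀ᶠ θ in 𝓝[<] (2 * Real.pi),
      -(ε' * (2 * Real.pi - θ) ^ (1 / 3 : ℝ)) ≤
        (∫ r in (0 : ℝ)..L, (P θ).real {ω | X₁ θ ω ≤ Real.exp (-(t + r))}) -
          ∫ r in (0 : ℝ)..L, w (t + r) := by
  set ρ₀ : ℝ := Real.exp (-(t + 1)) with hρ₀
  have hρ₀pos : 0 < ρ₀ := Real.exp_pos _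
  set C : ℝ := 2 * Real.sqrt (32 / ρ₀) + c with hC
  have hp : (1 / 3 : ℝ) < γ / (1 + 2 * γ) := by
    rw [div_lt_div_iff₀ (by norm_num) (by linarith)]
    linarith
  -- the bound `∫_t^{t+L} (u₂ - u₁^θ) ≤ C (2π - θ)^{γ/(1+2γ)}` on `(θ₁, 2π)`
  have hF : ∀ᶠ θ in 𝓝[<] (2 * Real.pi),
      (∫ s in t..t + L, ((P θ).real {ω | X₂ ω ≤ Real.exp (-s)} -
        (P θ).real {ω | X₁ θ ω ≤ Real.exp (-s)})) ≤ C * (2 * Real.pi - θ) ^ (γ / (1 + 2 * γ)) := by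
    have hmem : Ioo θ₁ (2 * Real.pi) ∈ 𝓝[<] (2 * Real.pi) := Ioo_mem_nhdsLT hθ₁
    filter_upwards [hmem] with θ hθ
    have hεθ : 0 < 2 * Real.pi - θ := by linarith [hθ.2]
    exact intervalIntegral_measureReal_sub_le_of_tail (P θ) (hX₁ θ) hX₂ hpos (hle θ) t hL1
      (by linarith) hεθ (fun r hr ↦ htail θ hθ ρ₀ hρ₀pos r hr)
  have hev := eventually_le_mul_rpow_one_third hp hF hε'
  filter_upwards [hev] with θ hθ
  -- rewrite the window integrals as `∫_t^{t+L}`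
  have hsub1 : (∫ r in (0 : ℝ)..L, (P θ).real {ω | X₁ θ ω ≤ Real.exp (-(t + r))}) =
      ∫ s in t..t + L, (P θ).real {ω | X₁ θ ω ≤ Real.exp (-s)} := by
    rw [intervalIntegral.integral_comp_add_left (fun s ↦ (P θ).real {ω | X₁ θ ω ≤ Real.exp (-s)}) t,
      add_zero]
  have hsub2 : (∫ r in (0 : ℝ)..L, w (t + r)) = ∫ s in t..t + L, (P θ).real {ω | X₂ ω ≤ Real.exp (-s)} := by
    rw [intervalIntegral.integral_comp_add_left (fun s ↦ w s) t, add_zero]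
    exact intervalIntegral.integral_congr fun s _ ↦ (hw θ s).symm
  have hi₁ : IntervalIntegrable (fun s ↦ (P θ).real {ω | X₁ θ ω ≤ Real.exp (-s)}) volume t (t + L) :=
    (antitone_measureReal_le_exp_neg (P θ) (X₁ θ)).intervalIntegrable
  have hi₂ : IntervalIntegrable (fun s ↦ (P θ).real {ω | X₂ ω ≤ Real.exp (-s)}) volume t (t + L) :=
    (antitone_measureReal_le_exp_neg (P θ) X₂).intervalIntegrable
  rw [hsub1, hsub2, ← intervalIntegral.integral_sub hi₁ hi₂]
  have : ∫ s in t..t + L, ((P θ).real {ω | X₁ θ ω ≤ Real.exp (-s)} - (P θ).real {ω | X₂ ω ≤ Real.exp (-s)}) =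
      -∫ s in t..t + L, ((P θ).real {ω | X₂ ω ≤ Real.exp (-s)} - (P θ).real {ω | X₁ θ ω ≤ Real.exp (-s)}) := by
    rw [← intervalIntegral.integral_neg]
    exact intervalIntegral.integral_congr fun s _ ↦ by ring
  rw [this]
  linarith

end Family

end Literature.Probability.Percolation
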